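import Mathlib
import Literature.Computability.AlgebraicComplexity.NewtonPolygonTauTransfer
import Summits.ValiantsHypothesis.ValiantsHypothesis.Theorems.NewtonUnitEquationsNewtonTauWeakVdpDefs

/-!
# `NewtonTauWeak` (stmt-ValiantsHypothesis-5904), line `euler-wronskian-vdp`: the chart pair count

Stub `stub_chartPairCount` of the lead's skeleton: fix `σ = ±1` and `F, G ∈ ℂ[μ][X,Y]`; along the
affine chart of weights `w_t = (σ, t)`, `t ∈ ℝ`, the set of pairs `(top_{w_t} G, top_{w_t} F)` realised
at the generic times `t` has at most `V(F) + V(G)` elements (`V = newtonVertexCount`).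

Proof.
* Tops are vertices: a strict `w`-top exponent is strictly exposed by the linear form
  `x ↦ w₀ x₀ + w₁ x₁`, hence an extreme point of the Newton polygon
  (`KPTT.mem_extremePoints_convexHull_of_linear`); distinct exponents give distinct points of `ℝ²`, so
  the set of exponents that are tops of `F` for some weight has at most `V(F)` elements
  (`ChartPairCount.ncard_tops_le`).
* Interval fibres: `wdeg (σ,t) e = σ e₀ + t e₁` is affine in `t`, so if `b` is the strict top of `F` at
  `t₁` and at `t₃` then also at every `t₂ ∈ [t₁, t₃]` (`ChartPairCount.isTop_of_between`).
* Counting: for two maps `f, g` on a linear order with interval fibres and every nonempty finite set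
  of times, `#{(g t, f t)} + 1 ≤ #{f t} + #{g t}` (`ChartPairCount.card_image_pair_le`, induction on
  the largest time: a new pair appearing at a new largest time has a new component, because if both
  components were old then, by the interval fibres through the previous largest time, the pair itself
  would be old); hence `#pairs ≤ #tops(F) + #tops(G) ≤ V(F) + V(G)`
  (`ChartPairCount.ncard_range_pair_le`).
The hypothesis `σ = ±1` is not used. [folklore]
-/

-- the namespace mandated for this Theorems file repeats the component `ValiantsHypothesis`
set_option linter.dupNamespace false

noncomputable section

namespace Summit.ValiantsHypothesis.ValiantsHypothesis.Theorems.NewtonUnitEquationsNewtonTauWeak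

open scoped BigOperators Polynomial
open MvPolynomial
open Literature.Computability.AlgebraicComplexity (newtonVertexCount)
open Summit.ValiantsHypothesis.ValiantsHypothesis.Theorems.NewtonTauWeakVdp

namespace ChartPairCount

/-! ## Counting pairs of values of two maps with interval fibres -/

/-- On a nonempty finite set of points of a linear order, two maps with interval fibres realise at
most `#values(f) + #values(g) - 1` pairs of values. [folklore] -/
theorem card_image_pair_le {L α β : Type*} [LinearOrder L] [DecidableEq α] [DecidableEq β]
    (f : L → α) (g : L → β)
    (hf : ∀ t₁ t₂ t₃ : L, t₁ ≤ t₂ → t₂ ≤ t₃ → f t₁ = f t₃ → f t₂ = f t₃)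
    (hg : ∀ t₁ t₂ t₃ : L, t₁ ≤ t₂ → t₂ ≤ t₃ → g t₁ = g t₃ → g t₂ = g t₃)
    (S : Finset L) (hS : S.Nonempty) :
    (S.image fun t => (g t, f t)).card + 1 ≤ (S.image f).card + (S.image g).card := by
  induction S using Finset.induction_on_max with
  | empty => exact absurd hS Finset.not_nonempty_empty
  | insert a s ha ih =>
    rcases s.eq_empty_or_nonempty with rfl | hs
    · simp
    replace ih := ih hs
    rw [Finset.image_insert, Finset.image_insert, Finset.image_insert]
    by_cases hp : (g a, f a) ∈ s.image fun t => (g t, f t)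
    · rw [Finset.insert_eq_of_mem hp]
      exact ih.trans (add_le_add (Finset.card_le_card (Finset.subset_insert _ _))
        (Finset.card_le_card (Finset.subset_insert _ _)))
    -- a new pair at the new largest time `a` has a new component
    have key : f a ∉ s.image f ∨ g a ∉ s.image g := by
      rw [← not_and_or]
      rintro ⟨hfa, hga⟩
      obtain ⟨x, hx, hfx⟩ := Finset.mem_image.mp hfa
      obtain ⟨y, hy, hgy⟩ := Finset.mem_image.mp hga
      have hm : s.max' hs ∈ s := s.max'_mem hs
      have hma : s.max' hs ≤ a := (ha _ hm).le
      have hfm : f (s.max' hs) = f a := hf x _ a (s.le_max' x hx) hma hfx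
      have hgm : g (s.max' hs) = g a := hg y _ a (s.le_max' y hy) hma hgy
      exact hp (Finset.mem_image.mpr ⟨s.max' hs, hm, by rw [hfm, hgm]⟩)
    rw [Finset.card_insert_of_notMem hp]
    rcases key with hfa | hga
    · rw [Finset.card_insert_of_notMem hfa]
      have := Finset.card_le_card (Finset.subset_insert (g a) (s.image g))
      omega
    · rw [Finset.card_insert_of_notMem hga]
      have := Finset.card_le_card (Finset.subset_insert (f a) (s.image f))
      omega

/-- Two maps with interval fibres on a linear order, each with finitely many values, realise at most
`#values(f) + #values(g)` pairs of values. [folklore] -/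
theorem ncard_range_pair_le {L α β : Type*} [LinearOrder L] (f : L → α) (g : L → β)
    (hf : ∀ t₁ t₂ t₃ : L, t₁ ≤ t₂ → t₂ ≤ t₃ → f t₁ = f t₃ → f t₂ = f t₃)
    (hg : ∀ t₁ t₂ t₃ : L, t₁ ≤ t₂ → t₂ ≤ t₃ → g t₁ = g t₃ → g t₂ = g t₃)
    (hff : (Set.range f).Finite) (hgf : (Set.range g).Finite) :
    (Set.range fun t => (g t, f t)).ncard ≤ (Set.range f).ncard + (Set.range g).ncard := by
  classical
  have hR : (Set.range fun t => (g t, f t)).Finite :=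
    (hgf.prod hff).subset (by rintro _ ⟨t, rfl⟩; exact Set.mk_mem_prod ⟨t, rfl⟩ ⟨t, rfl⟩)
  obtain ⟨S, -, hS⟩ := Finset.subset_set_image_iff.mp
    (show ((hR.toFinset : Finset (β × α)) : Set (β × α)) ⊆ (fun t => (g t, f t)) '' Set.univ by
      rw [Set.image_univ, hR.coe_toFinset])
  rw [Set.ncard_eq_toFinset_card _ hR, ← hS]
  rcases S.eq_empty_or_nonempty with rfl | hne
  · simp
  have h1 := card_image_pair_le f g hf hg S hne
  have h2 : (S.image f).card ≤ (Set.range f).ncard := by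
    rw [← Set.ncard_coe_finset]
    exact Set.ncard_le_ncard (by rw [Finset.coe_image]; exact Set.image_subset_range _ _) hff
  have h3 : (S.image g).card ≤ (Set.range g).ncard := by
    rw [← Set.ncard_coe_finset]
    exact Set.ncard_le_ncard (by rw [Finset.coe_image]; exact Set.image_subset_range _ _) hgf
  omega

/-! ## Tops are vertices -/

/-- The embedding `ℕ² → ℝ²` of exponents used by `newtonVertexCount` is injective. [folklore] -/
theorem emb_injective :
    Function.Injective (fun e : Fin 2 →₀ ℕ => fun i : Fin 2 => ((e i : ℕ) : ℝ)) := by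
  intro a b h
  ext i
  have hi : ((a i : ℕ) : ℝ) = ((b i : ℕ) : ℝ) := congrFun h i
  exact_mod_cast hi

/-- A strict `w`-top exponent of `F` is a vertex of the Newton polygon of `F`: it is strictly exposed
by the linear form `x ↦ w₀ x₀ + w₁ x₁`. [folklore] -/
theorem emb_mem_extremePoints_of_isTop {R : Type*} [CommSemiring R] {w : Fin 2 → ℝ}
    {F : MvPolynomial (Fin 2) R} {b : Fin 2 →₀ ℕ} (h : IsTop w F b) :
    (fun i : Fin 2 => ((b i : ℕ) : ℝ)) ∈ Set.extremePoints ℝ (convexHull ℝ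
      ((fun e : Fin 2 →₀ ℕ => fun i : Fin 2 => ((e i : ℕ) : ℝ)) '' (F.support : Set (Fin 2 →₀ ℕ)))) := by
  refine Literature.Computability.AlgebraicComplexity.KPTT.mem_extremePoints_convexHull_of_linear
    ⟨b, Finset.mem_coe.mpr h.mem, rfl⟩ (w 0 • LinearMap.proj 0 + w 1 • LinearMap.proj 1) ?_
  rintro _ ⟨e, he, rfl⟩ hne
  have hne' : e ≠ b := fun heb => hne (by rw [heb])
  have hlt := h.lt (Finset.mem_coe.mp he) hne'
  simp only [wdeg] at hlt
  simpa using hlt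

/-- The exponents that are strict tops of `F` for some weight form a finite set. [folklore] -/
theorem tops_finite {R : Type*} [CommSemiring R] (F : MvPolynomial (Fin 2) R) :
    {b : Fin 2 →₀ ℕ | ∃ w : Fin 2 → ℝ, IsTop w F b}.Finite :=
  F.support.finite_toSet.subset (by rintro b ⟨w, h⟩; exact Finset.mem_coe.mpr h.mem)

/-- At most `V(F)` exponents are strict tops of `F` for some weight. [folklore] -/
theorem ncard_tops_le {R : Type*} [CommSemiring R] (F : MvPolynomial (Fin 2) R) :
    {b : Fin 2 →₀ ℕ | ∃ w : Fin 2 → ℝ, IsTop w F b}.ncard ≤ newtonVertexCount F := by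
  unfold newtonVertexCount
  rw [← Set.ncard_image_of_injective _ emb_injective]
  refine Set.ncard_le_ncard ?_
    ((F.support.finite_toSet.image _).subset extremePoints_convexHull_subset)
  rintro _ ⟨b, ⟨w, hb⟩, rfl⟩
  exact emb_mem_extremePoints_of_isTop hb

/-! ## Interval fibres along an affine chart -/

/-- The weighted degree along the chart `t ↦ (σ, t)` is `σ e₀ + t e₁`, affine in `t`. [folklore] -/
theorem wdeg_chart (σ t : ℝ) (e : Fin 2 →₀ ℕ) :
    wdeg ![σ, t] e = σ * ((e 0 : ℕ) : ℝ) + t * ((e 1 : ℕ) : ℝ) := by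
  simp [wdeg]

/-- Interval fibres: if `b` is the strict top of `F` at the chart times `t₁ ≤ t₃`, then also at every
time `t₂ ∈ [t₁, t₃]`. [folklore] -/
theorem isTop_of_between {R : Type*} [CommSemiring R] {σ t₁ t₂ t₃ : ℝ}
    {F : MvPolynomial (Fin 2) R} {b : Fin 2 →₀ ℕ} (h₁ : IsTop ![σ, t₁] F b)
    (h₃ : IsTop ![σ, t₃] F b) (h12 : t₁ ≤ t₂) (h23 : t₂ ≤ t₃) : IsTop ![σ, t₂] F b := by
  refine ⟨h₁.mem, fun e he hne => ?_⟩
  have l₁ := h₁.lt he hne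
  have l₃ := h₃.lt he hne
  rw [wdeg_chart, wdeg_chart] at l₁ l₃ ⊢
  rcases le_total ((e 1 : ℕ) : ℝ) ((b 1 : ℕ) : ℝ) with hle | hle
  · nlinarith [mul_le_mul_of_nonneg_right h12 (sub_nonneg.mpr hle)]
  · nlinarith [mul_le_mul_of_nonneg_right h23 (sub_nonneg.mpr hle)]

end ChartPairCount

/-- **Chart pair count.** Fix `σ = ±1` and `F, G ∈ ℂ[μ][X,Y]`. Along the chart `w_t = (σ, t)`,
`t ∈ ℝ`, the set of realised pairs `(top_{w_t} G, top_{w_t} F)` (over the generic `t`) has at most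
`V(F) + V(G)` elements: tops are vertices, the top maps have interval fibres along the chart, and two
maps with interval fibres realise at most `#values + #values` pairs. [folklore] -/
theorem stub_chartPairCount :
    ∀ (σ : ℝ), (σ = 1 ∨ σ = -1) → ∀ (F G : MvPolynomial (Fin 2) Slope),
      {ab : (Fin 2 →₀ ℕ) × (Fin 2 →₀ ℕ) |
          ∃ t : ℝ, IsGeneric ![σ, t] ∧ IsTop ![σ, t] G ab.1 ∧ IsTop ![σ, t] F ab.2}.ncard ≤
        newtonVertexCount F + newtonVertexCount G := by
  intro σ _ F G
  classical
  by_cases hF : F = 0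
  · have h0 : {ab : (Fin 2 →₀ ℕ) × (Fin 2 →₀ ℕ) |
        ∃ t : ℝ, IsGeneric ![σ, t] ∧ IsTop ![σ, t] G ab.1 ∧ IsTop ![σ, t] F ab.2} = ∅ := by
      ext ab
      simp only [Set.mem_setOf_eq, Set.mem_empty_iff_false, iff_false]
      rintro ⟨t, -, -, h⟩
      exact h.ne_zero hF
    rw [h0, Set.ncard_empty]
    exact Nat.zero_le _
  by_cases hG : G = 0
  · have h0 : {ab : (Fin 2 →₀ ℕ) × (Fin 2 →₀ ℕ) |
        ∃ t : ℝ, IsGeneric ![σ, t] ∧ IsTop ![σ, t] G ab.1 ∧ IsTop ![σ, t] F ab.2} = ∅ := by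
      ext ab
      simp only [Set.mem_setOf_eq, Set.mem_empty_iff_false, iff_false]
      rintro ⟨t, -, h, -⟩
      exact h.ne_zero hG
    rw [h0, Set.ncard_empty]
    exact Nat.zero_le _
  -- the top maps on the generic chart times `L = {t // IsGeneric (σ, t)}`
  have hG' : ∀ t : {t : ℝ // IsGeneric ![σ, t]}, ∃ a, IsTop ![σ, (t : ℝ)] G a :=
    fun t => exists_isTop t.2 hG
  have hF' : ∀ t : {t : ℝ // IsGeneric ![σ, t]}, ∃ b, IsTop ![σ, (t : ℝ)] F b :=
    fun t => exists_isTop t.2 hF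
  choose g hg using hG'
  choose f hf using hF'
  have hP : {ab : (Fin 2 →₀ ℕ) × (Fin 2 →₀ ℕ) |
      ∃ t : ℝ, IsGeneric ![σ, t] ∧ IsTop ![σ, t] G ab.1 ∧ IsTop ![σ, t] F ab.2} =
      Set.range fun t => (g t, f t) := by
    ext ⟨a, b⟩
    simp only [Set.mem_setOf_eq, Set.mem_range, Prod.mk.injEq]
    constructor
    · rintro ⟨t, ht, ha, hb⟩
      exact ⟨⟨t, ht⟩, (hg ⟨t, ht⟩).unique ha, (hf ⟨t, ht⟩).unique hb⟩
    · rintro ⟨t, rfl, rfl⟩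
      exact ⟨t.1, t.2, hg t, hf t⟩
  rw [hP]
  have hfr : Set.range f ⊆ {b | ∃ w : Fin 2 → ℝ, IsTop w F b} := by
    rintro _ ⟨t, rfl⟩
    exact ⟨_, hf t⟩
  have hgr : Set.range g ⊆ {a | ∃ w : Fin 2 → ℝ, IsTop w G a} := by
    rintro _ ⟨t, rfl⟩
    exact ⟨_, hg t⟩
  have hfc : ∀ t₁ t₂ t₃ : {t : ℝ // IsGeneric ![σ, t]}, t₁ ≤ t₂ → t₂ ≤ t₃ → f t₁ = f t₃ →
      f t₂ = f t₃ := by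
    intro t₁ t₂ t₃ h12 h23 h13
    have h1 := hf t₁
    rw [h13] at h1
    exact (hf t₂).unique (ChartPairCount.isTop_of_between h1 (hf t₃) h12 h23)
  have hgc : ∀ t₁ t₂ t₃ : {t : ℝ // IsGeneric ![σ, t]}, t₁ ≤ t₂ → t₂ ≤ t₃ → g t₁ = g t₃ →
      g t₂ = g t₃ := by
    intro t₁ t₂ t₃ h12 h23 h13
    have h1 := hg t₁
    rw [h13] at h1
    exact (hg t₂).unique (ChartPairCount.isTop_of_between h1 (hg t₃) h12 h23)
  calc (Set.range fun t => (g t, f t)).ncard ≤ (Set.range f).ncard + (Set.range g).ncard :=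
        ChartPairCount.ncard_range_pair_le f g hfc hgc ((ChartPairCount.tops_finite F).subset hfr)
          ((ChartPairCount.tops_finite G).subset hgr)
    _ ≤ newtonVertexCount F + newtonVertexCount G :=
        add_le_add ((Set.ncard_le_ncard hfr (ChartPairCount.tops_finite F)).trans
            (ChartPairCount.ncard_tops_le F))
          ((Set.ncard_le_ncard hgr (ChartPairCount.tops_finite G)).trans
            (ChartPairCount.ncard_tops_le G))

end Summit.ValiantsHypothesis.ValiantsHypothesis.Theorems.NewtonUnitEquationsNewtonTauWeak

end
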